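/-
Copyright (c) 2026 the pub-hodgecm-mathlib formalisation cell (harness21).  Prover seat hodgecm-mathlib-F0P3b-p01 (g16): line LH3 «E3 ASSEMBLY» (closer stub `stub_N9`),
RULING #13 brick (A5) THE ASSEMBLY, part 1 (LH3-plan (g3) 2026-09-02T09:57:12Z; spec `F0/P3/F0P3b-p01/g16/SPEC-E3-assembly.v1.md` §4).
-/
import Literature.NumberTheory.Rogawski1990.ArchChartOrbGSplitCompactProduct       -- ★ (A1) p850949 (LH3-p02 (g4)): `chartOrbG_eq_prod_mul_integral_pi_prod_quotient`, `forall_mem_piNotMem_chartTorusGLoc_comm`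
import Literature.NumberTheory.Automorphic.ArchU21SplitOrbitNormalisedPiTransport   -- ★ (A2)+(A3) p851029 (this seat): `prod_normaliser_smul_integral_pi_descConj_eq_smul_integral_pi_prod_symm`; brings (A2) transports, (e3-1), (e3-4a)
import Literature.NumberTheory.Rogawski1990.ArchOrbFamGExtRealWallContinuous        -- ★ p850625∕p850640 (this lineage): `orbFamG_apply`
import HarnessLib

/-!
# (A5), part 1 — THE UNFOLDED MODEL OF THE RAW FAMILY `orbFamG` ON THE `G`-REGULAR SET («global parabolic descent at the split places», E3 §4 assembly)
# (Rogawski 1990 §4.9, §8.2–8.3; Shelstad 1979 §4; Gelbart 1975 §10; Varadarajan 1977 I §1.12)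

Topic `NumberTheory/Rogawski1990`; namespaces `Literature.NumberTheory.Automorphic.UnitaryGroup` (§1–§2) and `Literature.NumberTheory.Rogawski1990` (§0, §3).  THEOREMS ONLY
(no `def`, no `instance`, no notation, no `sorry`).  Cell `pub/hodgecm-mathlib`, crux H413 (`stmt-HodgeConjecture-24833`), F0∕P3c line LH3 (closer stub `stub_N9`), letter L1
`HcOrbitalFamiliesStatement`, clause (I₂); LH3-plan (g3) RULING #13 (2026-09-02), brick (A5) — spec owner and pen F0P3b-p01 (g16).  Count-neutral: HC_CM stays proved only
modulo its printed citations (2 remaining: hLiu418 = `stmt-HodgeConjecture-24832`, h413 = `stmt-HodgeConjecture-24833`) until rung 0 closes.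

CONTENTS.
* §0 `archRG_eq_prod_cpt_mul_prod_split` (Shelstad's normaliser = compact-place factors × split-place factors `Δ_w`), `contDiff_prod_cptFactor` (the compact part is entire),
  `splitCoord_eq_add_half_add_half` (`c = (0,φ,θ) + (x∕2,0,0) + (x∕2,0,0)`, the `htms` bookkeeping of the boost torus family).
* §1 `exists_map_cosetCongr_eq_smul_map_of_frame` — the Iwasawa reading `(cosetCongr φ)_* μ = C • ((k,n) ↦ k n T)_*(κ ⊗ μ_N)`, `0 < C`, for a GIVEN frame `φ` (★ (e3-1) after ★ (A2)'s transports).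
* §2 `integral_prod_eq_integral_swap_descConj` — swap of the two factors folding the compact-place conjugation into ONE `descConj` (the shape of ★ (A4)'s model).
* §3 **`orbFamG_eq_unfoldedModel_of_regG`** — (A5a): on `RegG S′`, `orbFamG = (compact factors) · (∏ t_w(B′_w)) · (∏ C_w) · ∫ (unfolded integrand) d((⊗_{S′} κ⊗μ_N) ⊗ compact quotient)`.
The head `contDiffOn_orbFamGExt_inRegG` (clause (I₂), hypothesis-free) is part 2, `ArchOrbFamGExtSmoothInRegG`.

References: J. Rogawski, *Automorphic Representations of Unitary Groups in Three Variables*, Ann. of Math. Stud. 123 (1990), §4.9 pp. 54–55, §8.2–8.3 pp. 118–124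
[Rogawski1990]; D. Shelstad, *Characters and inner forms of a quasi-split group over ℝ*, Compositio Math. 39 (1979), §4 [Shelstad1979]; S. Gelbart, *Automorphic Forms on
Adele Groups* (1975), §10 [Gelbart1975]; V. S. Varadarajan, *Harmonic Analysis on Real Reductive Groups*, LNM 576 (1977), I §1.12 [Varadarajan1977]; A. Deitmar,
S. Echterhoff, *Principles of Harmonic Analysis*, 2nd ed. (2014), Thm. 1.5.3, Lemma 9.3.3 [DeitmarEchterhoff2014].
-/

set_option autoImplicit false

noncomputable section

open MeasureTheory MeasureTheory.Measure Set NumberField NumberField.InfinitePlace Complex Topology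
open Literature.MeasureTheory.Group Literature.NumberTheory.Automorphic Literature.NumberTheory.Automorphic.UnitaryGroup Literature.NumberTheory.Automorphic.ArchCartan
open scoped ContDiff Classical ENNReal NNReal MatrixGroups

namespace Literature.NumberTheory.Rogawski1990

/-! ## §0 Shelstad's normaliser splits as «compact-place factors × split-place factors»; the compact part is smooth EVERYWHERE -/

section Normaliser

open Complex

variable {W : Type*} [Fintype W] [DecidableEq W]

/-- **`archRG S′ c = (∏_{w ∉ S′} signed compact factors) · ∏_{w ∈ S′} Δ_w(c w)`** with `Δ_w(c w) = |eˣ − e⁻ˣ|·|e^{x+iθ} − e^{iφ}|·|e^{−x+iθ} − e^{iφ}|` the split-place factor — the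
(A5) bookkeeping form: the split product is indexed by the SUBTYPE `↥S′` (the index type of (A3)'s `Measure.pi`), the compact product by `univ.filter (· ∉ S′)`.
[cite: Shelstad1979, §4 p. 22] [cite: Rogawski1990, §8.2 p. 118] -/
theorem archRG_eq_prod_cpt_mul_prod_split (S' : Finset W) (c : W → Fin 3 → ℝ) :
    archRG S' c =
      (∏ w ∈ Finset.univ.filter (fun w => w ∉ S'),
          (1 - (Circle.exp (c w 1 - c w 0) : ℂ)) * (1 - (Circle.exp (c w 2 - c w 0) : ℂ)) * (1 - (Circle.exp (c w 2 - c w 1) : ℂ))) *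
        ∏ w : ↥S', ((|Real.exp (c w 0) - Real.exp (-c w 0)| *
          ‖Complex.exp (c w 0 + c w 2 * I) - Complex.exp (c w 1 * I)‖ * ‖Complex.exp (-c w 0 + c w 2 * I) - Complex.exp (c w 1 * I)‖ : ℝ) : ℂ) := by
  unfold archRG
  rw [← Finset.prod_filter_mul_prod_filter_not Finset.univ (fun w => w ∈ S'), mul_comm]
  congr 1
  · refine Finset.prod_congr rfl fun w hw => ?_
    rw [Finset.mem_filter] at hw
    rw [if_neg hw.2]
  · rw [Finset.filter_mem_eq_inter, Finset.univ_inter, ← Finset.prod_coe_sort S']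
    refine Finset.prod_congr rfl fun w _ => ?_
    rw [if_pos w.2]

/-- **The compact-place part of `archRG` is `C^∞` on ALL of the coordinate space** (the signed factors `1 − e^{i(θ_j − θ_i)}` are entire). [cite: Shelstad1979, §4 p. 22] -/
theorem contDiff_prod_cptFactor (S' : Finset W) :
    ContDiff ℝ ∞ fun c : W → Fin 3 → ℝ => ∏ w ∈ Finset.univ.filter (fun w => w ∉ S'),
      (1 - (Circle.exp (c w 1 - c w 0) : ℂ)) * (1 - (Circle.exp (c w 2 - c w 0) : ℂ)) * (1 - (Circle.exp (c w 2 - c w 1) : ℂ)) := by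
  refine contDiff_prod fun w _ => ?_
  have he : ∀ i j : Fin 3, ContDiff ℝ ∞ fun c : W → Fin 3 → ℝ => (Circle.exp (c w j - c w i) : ℂ) := by
    intro i j
    have h : (fun c : W → Fin 3 → ℝ => (Circle.exp (c w j - c w i) : ℂ)) = fun c => Complex.exp (((c w j - c w i : ℝ) : ℂ) * I) :=
      funext fun c => Circle.coe_exp _
    rw [h]
    exact Complex.contDiff_exp.comp ((ofRealCLM.contDiff.comp ((contDiff_apply_apply ℝ ℝ w j).sub (contDiff_apply_apply ℝ ℝ w i))).mul contDiff_const)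
  exact ((contDiff_const.sub (he 0 1)).mul (contDiff_const.sub (he 0 2))).mul (contDiff_const.sub (he 1 2))


/-- The split-chart coordinate splits as `c = (0, φ, θ) + (x∕2, 0, 0) + (x∕2, 0, 0)` — so `τ c = τ(0, φ, θ) · τ(x∕2, 0, 0) · τ(x∕2, 0, 0)` for the torus family of ★ `exists_torusU_boostEig_family`
(the `htms : t = m * s * s` binder of ★ (e3-4a) ∕ (A3)). [cite: Knapp1986, Ch. V §3] -/
theorem splitCoord_eq_add_half_add_half (c : Fin 3 → ℝ) : c = ![0, c 1, c 2] + ![c 0 / 2, 0, 0] + ![c 0 / 2, 0, 0] := by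
  funext i
  fin_cases i <;> simp

end Normaliser

end Literature.NumberTheory.Rogawski1990

namespace Literature.NumberTheory.Automorphic.UnitaryGroup

/-! ## §1 The `hμC` of a transported invariant quotient measure, for a GIVEN frame `φ` -/

section Frame

variable {J : Matrix (Fin 3) (Fin 3) ℂ} (hJ : J = (StdForm.antidiagonal 3).over ℂ)
  [MeasurableSpace ↥(unitaryGroupOfForm (starRingEnd ℂ) J)] [BorelSpace ↥(unitaryGroupOfForm (starRingEnd ℂ) J)]
  [MeasurableSpace (↥(unitaryGroupOfForm (starRingEnd ℂ) J) ⧸ torusU (starRingEnd ℂ) J)] [BorelSpace (↥(unitaryGroupOfForm (starRingEnd ℂ) J) ⧸ torusU (starRingEnd ℂ) J)]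
  {U : Type*} [Group U] [TopologicalSpace U] (T' : Subgroup U) [MeasurableSpace (U ⧸ T')] [BorelSpace (U ⧸ T')]

include hJ in
/-- **Iwasawa reading of a transported invariant measure** (★ (e3-1) `exists_measure_quotient_torusU_complex_three_eq_smul_map` after ★ (A2)'s transports
`smulInvariantMeasure_map_cosetCongr_of_smulInvariantMeasure`, `isFiniteMeasureOnCompacts_map_cosetCongr`, `map_cosetCongr_subgroup_ne_zero`): for ANY continuous isomorphism
`φ : U ≃ₜ* U(J₃)(ℂ)` carrying `T′` onto `torusU`, any `U`-invariant Radon `μ ≠ 0` on `U ⧸ T′`, compact `K` with `U(J₃) = K·B` and Haar `κ`, `μ_N`: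
`(cosetCongr φ)_* μ = C • ((k, n) ↦ k n T)_*(κ ⊗ μ_N)` with `0 < C`. [cite: Gelbart1975, Thm. 9.22 (iii)] [cite: DeitmarEchterhoff2014, Thm. 1.5.3] [cite: Rogawski1990, §4.13 pp. 64–67] -/
theorem exists_map_cosetCongr_eq_smul_map_of_frame (φ : U ≃ₜ* ↥(unitaryGroupOfForm (starRingEnd ℂ) J))
    (hφT : ∀ g : U, φ.toMulEquiv g ∈ torusU (starRingEnd ℂ) J ↔ g ∈ T')
    {K : Subgroup ↥(unitaryGroupOfForm (starRingEnd ℂ) J)} (hK : IsCompact (K : Set ↥(unitaryGroupOfForm (starRingEnd ℂ) J)))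
    (hKB : ∀ g : ↥(unitaryGroupOfForm (starRingEnd ℂ) J), ∃ k ∈ K, ∃ b ∈ borelU (starRingEnd ℂ) J, g = k * b)
    (κ : Measure ↥K) [IsHaarMeasure κ] (μN : Measure ↥(unipotentU (starRingEnd ℂ) J)) [IsHaarMeasure μN]
    (μ : Measure (U ⧸ T')) [SMulInvariantMeasure U (U ⧸ T') μ] [IsFiniteMeasureOnCompacts μ] (hμ : μ ≠ 0) :
    ∃ C : ℝ≥0, 0 < C ∧ μ.map (cosetCongr φ.toMulEquiv T' (torusU (starRingEnd ℂ) J) hφT) = C • Measure.map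
      (fun p : ↥K × ↥(unipotentU (starRingEnd ℂ) J) =>
        (QuotientGroup.mk ((p.1 : ↥(unitaryGroupOfForm (starRingEnd ℂ) J)) * (p.2 : ↥(unitaryGroupOfForm (starRingEnd ℂ) J))) :
          ↥(unitaryGroupOfForm (starRingEnd ℂ) J) ⧸ torusU (starRingEnd ℂ) J))
      (κ.prod μN) := by
  have he : Continuous φ.toMulEquiv := φ.continuous
  have hes : Continuous φ.toMulEquiv.symm := φ.symm.continuous
  haveI := Literature.MeasureTheory.Group.smulInvariantMeasure_map_cosetCongr_of_smulInvariantMeasure φ.toMulEquiv _ _ hφT he μ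
  haveI := Literature.MeasureTheory.Group.isFiniteMeasureOnCompacts_map_cosetCongr φ.toMulEquiv _ _ hφT he hes μ
  have hne := map_cosetCongr_subgroup_ne_zero φ.toMulEquiv he _ _ hφT hμ
  haveI : LocallyCompactSpace ↥(unitaryGroupOfForm (starRingEnd ℂ) J) := locallyCompactSpace_unitaryGroupOfForm_complex J
  have hT : IsClosed (torusU (starRingEnd ℂ) J : Set ↥(unitaryGroupOfForm (starRingEnd ℂ) J)) := isClosed_torusU_of_t1Space _ _
  haveI : LocallyCompactSpace ↥(torusU (starRingEnd ℂ) J) := hT.isClosedEmbedding_subtypeVal.locallyCompactSpace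
  obtain ⟨αT, hαT⟩ : ∃ αT : Measure ↥(torusU (starRingEnd ℂ) J), αT.IsHaarMeasure := ⟨Measure.haar, inferInstance⟩
  exact exists_measure_quotient_torusU_complex_three_eq_smul_map hJ hK hKB κ αT μN _ hne

end Frame

/-! ## §2 Swapping the factors and folding the compact-place conjugation into ONE `descConj` -/

section Swap

variable {Xs : Type*} [MeasurableSpace Xs] {Gc : Type*} [Group Gc] (γ : Gc) (M : Subgroup Gc) (hM : ∀ m ∈ M, m * γ = γ * m)
  [MeasurableSpace (Gc ⧸ M)] (νs : Measure Xs) (Qc : Measure (Gc ⧸ M)) [SFinite νs] [SFinite Qc]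
  {Z : Type*} {E : Type*} [NormedAddCommGroup E] [NormedSpace ℝ E]

/-- **(A5b) THE BRIDGE TO THE MODEL'S SHAPE**: an integral over `X_s × (G_c ⧸ M_c)` whose integrand on the class `g M_c` reads `a (r (g γ g⁻¹, u))` is the integral over
`(G_c ⧸ M_c) × X_s` of ONE orbital integrand `descConj γ M_c (g ↦ a (r (g, u)))` (Mathlib `integral_prod_swap` — no measurability needed — then ★ `descConj_mk` class by class).
[cite: DeitmarEchterhoff2014, Lemma 9.3.3] [cite: Folland1995, §2.6 (2.52)] -/
theorem integral_prod_eq_integral_swap_descConj (a : Z → E) (r : Gc × Xs → Z) (F : Xs × (Gc ⧸ M) → E)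
    (hF : ∀ (u : Xs) (g : Gc), F (u, (QuotientGroup.mk g : Gc ⧸ M)) = a (r (g * γ * g⁻¹, u))) :
    ∫ q, F q ∂(νs.prod Qc) = ∫ w : (Gc ⧸ M) × Xs, descConj γ M hM (fun g => a (r (g, w.2))) w.1 ∂(Qc.prod νs) := by
  rw [← integral_prod_swap F]
  refine integral_congr_ae (Filter.Eventually.of_forall fun w => ?_)
  obtain ⟨x, u⟩ := w
  induction x using QuotientGroup.induction_on with
  | H g =>
    show F (u, (QuotientGroup.mk g : Gc ⧸ M)) = descConj γ M hM (fun g => a (r (g, u))) (QuotientGroup.mk g : Gc ⧸ M)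
    rw [hF, descConj_mk]

end Swap

end Literature.NumberTheory.Automorphic.UnitaryGroup

namespace Literature.NumberTheory.Rogawski1990

/-! ## §3 (A5a): the unfolded model of `orbFamG` on the `G`-regular set -/

section Assembly

variable (L : Type) [Field L] [NumberField L] [IsCMField L] (α : Fin 3 → L) (S' : Finset {w : InfinitePlace L // IsComplex w})
  [∀ w : {w : InfinitePlace L // IsComplex w}, MeasurableSpace ↥(archLocal L 3 (Matrix.diagonal α) w)]
  [∀ w : {w : InfinitePlace L // IsComplex w}, BorelSpace ↥(archLocal L 3 (Matrix.diagonal α) w)]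
  [∀ w : {w : InfinitePlace L // IsComplex w}, LocallyCompactSpace ↥(archLocal L 3 (Matrix.diagonal α) w)]
  [∀ w : {w : InfinitePlace L // IsComplex w}, SecondCountableTopology ↥(archLocal L 3 (Matrix.diagonal α) w)]
  [MeasurableSpace ↥(arch (↥(maximalRealSubfield L)) L (IsCMField.complexConj L) 3 (Matrix.diagonal α))]
  [BorelSpace ↥(arch (↥(maximalRealSubfield L)) L (IsCMField.complexConj L) 3 (Matrix.diagonal α))]
  [∀ w : {w : InfinitePlace L // IsComplex w}, MeasurableSpace (↥(archLocal L 3 (Matrix.diagonal α) w) ⧸ chartTorusGLoc L α w S')]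
  [∀ w : {w : InfinitePlace L // IsComplex w}, BorelSpace (↥(archLocal L 3 (Matrix.diagonal α) w) ⧸ chartTorusGLoc L α w S')]
  (ν'w : ∀ w : {w : InfinitePlace L // IsComplex w}, Measure ↥(archLocal L 3 (Matrix.diagonal α) w)) [∀ w, (ν'w w).IsHaarMeasure] [∀ w, (ν'w w).IsMulRightInvariant]
  (ν' : Measure ↥(arch (↥(maximalRealSubfield L)) L (IsCMField.complexConj L) 3 (Matrix.diagonal α))) [ν'.IsHaarMeasure] [ν'.IsMulRightInvariant]
  (hν : ν' = (Measure.pi ν'w).map (archPiEquivCM 3 L (Matrix.diagonal α)).symm)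
  (t : ∀ w : {w : InfinitePlace L // IsComplex w}, Measure ↥(chartTorusGLoc L α w S')) [∀ w, (t w).IsHaarMeasure] [∀ w, (t w).IsInvInvariant]
  -- the compact factor (as in ★ (A1) §3)
  [MeasurableSpace ((∀ w : {w : {w : InfinitePlace L // IsComplex w} // w ∉ S'}, ↥(archLocal L 3 (Matrix.diagonal α) w.1)) ⧸
    Subgroup.pi Set.univ (fun w : {w : {w : InfinitePlace L // IsComplex w} // w ∉ S'} => chartTorusGLoc L α w.1 S'))]
  [BorelSpace ((∀ w : {w : {w : InfinitePlace L // IsComplex w} // w ∉ S'}, ↥(archLocal L 3 (Matrix.diagonal α) w.1)) ⧸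
    Subgroup.pi Set.univ (fun w : {w : {w : InfinitePlace L // IsComplex w} // w ∉ S'} => chartTorusGLoc L α w.1 S'))]
  (ρcpt : Measure ↥(Subgroup.pi Set.univ (fun w : {w : {w : InfinitePlace L // IsComplex w} // w ∉ S'} => chartTorusGLoc L α w.1 S')))
  [ρcpt.IsHaarMeasure] [ρcpt.IsInvInvariant]
  (hρ : Measure.map (subgroupPiCoords fun w : {w : {w : InfinitePlace L // IsComplex w} // w ∉ S'} => chartTorusGLoc L α w.1 S') ρcpt =
    Measure.pi fun w : {w : {w : InfinitePlace L // IsComplex w} // w ∉ S'} => t w.1)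
  -- the standard split group `U(J₃)(ℂ)` and the per-place transports (★ (A2))
  {J : Matrix (Fin 3) (Fin 3) ℂ} (hJ : J = (StdForm.antidiagonal 3).over ℂ)
  [MeasurableSpace ↥(unitaryGroupOfForm (starRingEnd ℂ) J)] [BorelSpace ↥(unitaryGroupOfForm (starRingEnd ℂ) J)]
  [MeasurableSpace (↥(unitaryGroupOfForm (starRingEnd ℂ) J) ⧸ torusU (starRingEnd ℂ) J)] [BorelSpace (↥(unitaryGroupOfForm (starRingEnd ℂ) J) ⧸ torusU (starRingEnd ℂ) J)]
  (φ : ∀ w : {w : {w : InfinitePlace L // IsComplex w} // w ∈ S'}, ↥(archLocal L 3 (Matrix.diagonal α) w.1) ≃ₜ* ↥(unitaryGroupOfForm (starRingEnd ℂ) J))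
  (hφT : ∀ (w : {w : {w : InfinitePlace L // IsComplex w} // w ∈ S'}) (g : ↥(archLocal L 3 (Matrix.diagonal α) w.1)),
    (φ w).toMulEquiv g ∈ torusU (starRingEnd ℂ) J ↔ g ∈ chartTorusGLoc L α w.1 S')
  (hφγ : ∀ (w : {w : {w : InfinitePlace L // IsComplex w} // w ∈ S'}) (cw : Fin 3 → ℝ), φ w (gprimeBlockAt L α w.1 S' cw) ∈ torusU (starRingEnd ℂ) J)
  (hφd : ∀ (w : {w : {w : InfinitePlace L // IsComplex w} // w ∈ S'}) (cw : Fin 3 → ℝ),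
    glDiagonal 3 ℂ (fun i => Units.mk0 (boostEig cw i) (boostEig_ne_zero cw i)) = ((φ w (gprimeBlockAt L α w.1 S' cw) : ↥(unitaryGroupOfForm (starRingEnd ℂ) J)) : GL (Fin 3) ℂ))
  {K : Subgroup ↥(unitaryGroupOfForm (starRingEnd ℂ) J)} (κ : Measure ↥K) [SigmaFinite κ]
  (μN : Measure ↥(unipotentU (starRingEnd ℂ) J)) [IsHaarMeasure μN]
  {C : {w : {w : InfinitePlace L // IsComplex w} // w ∈ S'} → ℝ≥0}
  (hμC : ∀ w : {w : {w : InfinitePlace L // IsComplex w} // w ∈ S'},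
    (quotientMeasure (chartTorusGLoc L α w.1 S') (t w.1) (isClosed_chartTorusGLoc L α w.1 S') (ν'w w.1)).map
        (cosetCongr (φ w).toMulEquiv (chartTorusGLoc L α w.1 S') (torusU (starRingEnd ℂ) J) (hφT w)) =
      C w • Measure.map
        (fun p : ↥K × ↥(unipotentU (starRingEnd ℂ) J) =>
          (QuotientGroup.mk ((p.1 : ↥(unitaryGroupOfForm (starRingEnd ℂ) J)) * (p.2 : ↥(unitaryGroupOfForm (starRingEnd ℂ) J))) :
            ↥(unitaryGroupOfForm (starRingEnd ℂ) J) ⧸ torusU (starRingEnd ℂ) J))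
        (κ.prod μN))
  -- the boost torus family on `U(J₃)(ℂ)` (★ `exists_torusU_boostEig_family`)
  (τ : (Fin 3 → ℝ) → ↥(unitaryGroupOfForm (starRingEnd ℂ) J)) (hτT : ∀ c, τ c ∈ torusU (starRingEnd ℂ) J)
  (hτcoe : ∀ c, (((τ c : ↥(unitaryGroupOfForm (starRingEnd ℂ) J)) : GL (Fin 3) ℂ) : Matrix (Fin 3) (Fin 3) ℂ) = Matrix.diagonal (boostEig c))
  (hτmul : ∀ c c', τ (c + c') = τ c * τ c')
  (hτd : ∀ c, ∃ d : Fin 3 → ℂˣ, glDiagonal 3 ℂ d = ((τ c : ↥(unitaryGroupOfForm (starRingEnd ℂ) J)) : GL (Fin 3) ℂ) ∧ ∀ i, (d i : ℂ) = boostEig c i)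

include hν hρ hJ hφT hφd hμC hτT hτcoe hτmul hτd in
/-- **(A5a) THE UNFOLDED MODEL EQUALS THE RAW FAMILY ON THE `G`-REGULAR SET.**  Diagonal house frame (`hα`), admissible `S′` (`hS′`), a Haar measure `ν′` on `G′_∞` in the
product reading `hν` (★ `exists_isHaarMeasure_eq_map_archPiEquivCM_symm_pi`), inversion-invariant Haar measures `t_w` on the local chart tori and `ρ_cpt` on `Π_{w∉S′} T′_w` with
coordinates `⊗ t_w` (`hρ`), per split place `w ∈ S′` a frame `φ_w : U(α)_w ≃ₜ* U(J₃)(ℂ)` carrying `T′_w` onto `torusU` (`hφT`) and the chart point to `diag(boostEig)` (`hφd`), ONE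
compact `K ≤ U(J₃)(ℂ)` with σ-finite `κ` and a Haar measure `μ_N` on `N` reading every transported local quotient measure as `C_w • ((k,n) ↦ k n T)_*(κ ⊗ μ_N)` (`hμC`), and the boost
torus family `τ` (★ `exists_torusU_boostEig_family`: `hτT hτcoe hτmul hτd`).  THEN for a continuous test function `a′` and every `G`-REGULAR `c`:
**`orbFamG ν′ a′ S′ c = (∏_{w∉S′} (1−e^{i(φ−θ)})(1−e^{i(ψ−θ)})(1−e^{i(ψ−φ)})) · (∏_w t_w(B′_w)) · (∏_{w∈S′} C_w) · ∫ a′(e⁻¹(w ↦ [w ∈ S′] φ_w⁻¹(k_w · τ(0,φ_w,θ_w) τ(x_w∕2,0,0) n_w τ(x_w∕2,0,0) · k_w⁻¹) ∣ [w ∉ S′] (g γ_cpt(c) g⁻¹)_w)) d((⊗_{w∈S′} (κ ⊗ μ_N)) ⊗ ((⊗_{w∉S′} ν′_w) ∕ ρ_cpt))`**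
— Shelstad's normaliser `archRG` (★ `orbFamG_apply`) splits (§0), ★ (A1) `chartOrbG_eq_prod_mul_integral_pi_prod_quotient` writes `chartOrbG` as ONE integral over
`(Π_{w∈S′} U_w⧸T′_w) × ((Π_{w∉S′} U_w)⧸Π T′_w)`, and ★ (A2)+(A3) `prod_normaliser_smul_integral_pi_descConj_eq_smul_integral_pi_prod_symm` absorbs EVERY split factor `Δ_w` into the
`K × N` chart: the right-hand side has no `Δ_w⁻¹`, no singularity at the real walls `x_w = 0`, at the scalar split points or at corners of any depth (the smooth MODEL of ★ (A4)
`contDiffOn_smoothModel_inRegG`, up to the swap of §2). [cite: Rogawski1990, §4.9 (4.9.1)–(4.9.2) p. 55; §8.2 p. 122; §8.3 p. 124] [cite: Shelstad1979, §4 pp. 22–24]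
[cite: Gelbart1975, §10 p. 155 (10.19)] [cite: Varadarajan1977, I §1.12] -/
theorem orbFamG_eq_unfoldedModel_of_regG (hα : ∀ i, α i ≠ 0) (hS' : ∀ w, w ∈ S' → w ∈ splitChartPlaces L α)
    (a' : ↥(arch (↥(maximalRealSubfield L)) L (IsCMField.complexConj L) 3 (Matrix.diagonal α)) → ℂ) (ha'c : Continuous a')
    {c : {w : InfinitePlace L // IsComplex w} → Fin 3 → ℝ} (hc : c ∈ RegG S') :
    orbFamG L α ν' a' S' c =
      (∏ w ∈ Finset.univ.filter (fun w => w ∉ S'),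
          ((1 - (Circle.exp (c w 1 - c w 0) : ℂ)) * (1 - (Circle.exp (c w 2 - c w 0) : ℂ)) * (1 - (Circle.exp (c w 2 - c w 1) : ℂ)))) *
        (∏ w, ((t w (chartBoxImgGLoc L α w S')).toReal : ℂ)) * ((∏ w : {w : {w : InfinitePlace L // IsComplex w} // w ∈ S'}, (C w : ℝ) : ℝ) : ℂ) *
        ∫ q : ({w : {w : InfinitePlace L // IsComplex w} // w ∈ S'} → ↥K × ↥(unipotentU (starRingEnd ℂ) J)) ×
              ((∀ w : {w : {w : InfinitePlace L // IsComplex w} // w ∉ S'}, ↥(archLocal L 3 (Matrix.diagonal α) w.1)) ⧸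
                Subgroup.pi Set.univ (fun w : {w : {w : InfinitePlace L // IsComplex w} // w ∉ S'} => chartTorusGLoc L α w.1 S')),
          a' ((archPiEquivCM 3 L (Matrix.diagonal α)).symm fun w =>
            if h : w ∈ S' then
              (φ ⟨w, h⟩).symm (((q.1 ⟨w, h⟩).1 : ↥(unitaryGroupOfForm (starRingEnd ℂ) J)) *
                (τ ![0, c w 1, c w 2] * τ ![c w 0 / 2, 0, 0] * ((q.1 ⟨w, h⟩).2 : ↥(unitaryGroupOfForm (starRingEnd ℂ) J)) * τ ![c w 0 / 2, 0, 0]) *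
                ((q.1 ⟨w, h⟩).1 : ↥(unitaryGroupOfForm (starRingEnd ℂ) J))⁻¹)
            else
              descConj (fun w : {w : {w : InfinitePlace L // IsComplex w} // w ∉ S'} => gprimeBlock L α w.1 S' c)
                (Subgroup.pi Set.univ (fun w : {w : {w : InfinitePlace L // IsComplex w} // w ∉ S'} => chartTorusGLoc L α w.1 S'))
                (forall_mem_piNotMem_chartTorusGLoc_comm L α S' c)
                (fun g => (g ⟨w, h⟩ : ↥(archLocal L 3 (Matrix.diagonal α) w))) q.2)
          ∂((Measure.pi fun _ : {w : {w : InfinitePlace L // IsComplex w} // w ∈ S'} => κ.prod μN).prod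
            (quotientMeasure (Subgroup.pi Set.univ (fun w : {w : {w : InfinitePlace L // IsComplex w} // w ∉ S'} => chartTorusGLoc L α w.1 S')) ρcpt
              (isClosed_coe_pi _ fun w => isClosed_chartTorusGLoc L α w.1 S')
              (Measure.pi fun w : {w : {w : InfinitePlace L // IsComplex w} // w ∉ S'} => ν'w w.1))) := by
  rw [orbFamG_apply L α ν' a' hS' c, archRG_eq_prod_cpt_mul_prod_split S' c,
    chartOrbG_eq_prod_mul_integral_pi_prod_quotient L α S' ν'w ν' hν t hα hS' ρcpt hρ a' c]
  -- instances (as in ★ (A1) §3): the local and the compact quotient measures are σ-finite ∕ s-finite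
  haveI : ∀ w : {w : InfinitePlace L // IsComplex w}, SecondCountableTopology (↥(archLocal L 3 (Matrix.diagonal α) w) ⧸ chartTorusGLoc L α w S') := fun w => inferInstance
  haveI : ∀ w : {w : {w : InfinitePlace L // IsComplex w} // w ∈ S'},
      SigmaFinite (quotientMeasure (chartTorusGLoc L α w.1 S') (t w.1) (isClosed_chartTorusGLoc L α w.1 S') (ν'w w.1)) := fun w => inferInstance
  have hMc : IsClosed ((Subgroup.pi Set.univ (fun w : {w : {w : InfinitePlace L // IsComplex w} // w ∉ S'} => chartTorusGLoc L α w.1 S')) :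
      Set (∀ w : {w : {w : InfinitePlace L // IsComplex w} // w ∉ S'}, ↥(archLocal L 3 (Matrix.diagonal α) w.1))) :=
    isClosed_coe_pi _ fun w => isClosed_chartTorusGLoc L α w.1 S'
  haveI : LocallyCompactSpace ↥(Subgroup.pi Set.univ (fun w : {w : {w : InfinitePlace L // IsComplex w} // w ∉ S'} => chartTorusGLoc L α w.1 S')) :=
    hMc.isClosedEmbedding_subtypeVal.locallyCompactSpace
  haveI : SecondCountableTopology ↥(Subgroup.pi Set.univ (fun w : {w : {w : InfinitePlace L // IsComplex w} // w ∉ S'} => chartTorusGLoc L α w.1 S')) :=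
    TopologicalSpace.Subtype.secondCountableTopology _
  haveI : SFinite ρcpt := inferInstance
  -- torus data on `U(J₃)(ℂ)`: `φ_w γ_w(c) = τ(c_w) = τ(0,θ,φ) τ(x∕2,0,0) τ(x∕2,0,0)`, diagonal units from `hτd`
  choose d hd hdc using hτd
  have hγt : ∀ w : {w : {w : InfinitePlace L // IsComplex w} // w ∈ S'}, (φ w) (gprimeBlockAt L α w.1 S' (c w.1)) = τ (c w.1) := fun w => by
    apply Subtype.ext
    apply Units.ext
    rw [← hφd w (c w.1), coe_glDiagonal, hτcoe]
    rfl
  have htms : ∀ w : {w : {w : InfinitePlace L // IsComplex w} // w ∈ S'},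
      τ (c w.1) = τ ![0, c w.1 1, c w.1 2] * τ ![c w.1 0 / 2, 0, 0] * τ ![c w.1 0 / 2, 0, 0] := fun w => by
    conv_lhs => rw [splitCoord_eq_add_half_add_half (c w.1)]
    rw [hτmul, hτmul]
  -- the recombined integrand is continuous in (split variables, compact class)
  have hFc : Continuous fun p : (∀ w : {w : {w : InfinitePlace L // IsComplex w} // w ∈ S'}, ↥(archLocal L 3 (Matrix.diagonal α) w.1)) ×
      ((∀ w : {w : {w : InfinitePlace L // IsComplex w} // w ∉ S'}, ↥(archLocal L 3 (Matrix.diagonal α) w.1)) ⧸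
        Subgroup.pi Set.univ (fun w : {w : {w : InfinitePlace L // IsComplex w} // w ∉ S'} => chartTorusGLoc L α w.1 S')) =>
      a' ((archPiEquivCM 3 L (Matrix.diagonal α)).symm fun w =>
        if h : w ∈ S' then p.1 ⟨w, h⟩
        else
          descConj (fun w : {w : {w : InfinitePlace L // IsComplex w} // w ∉ S'} => gprimeBlock L α w.1 S' c)
            (Subgroup.pi Set.univ (fun w : {w : {w : InfinitePlace L // IsComplex w} // w ∉ S'} => chartTorusGLoc L α w.1 S'))
            (forall_mem_piNotMem_chartTorusGLoc_comm L α S' c)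
            (fun g => (g ⟨w, h⟩ : ↥(archLocal L 3 (Matrix.diagonal α) w))) p.2) := by
    refine ha'c.comp ((archPiEquivCM 3 L (Matrix.diagonal α)).symm.continuous.comp (continuous_pi fun w => ?_))
    by_cases h : w ∈ S'
    · simp only [dif_pos h]
      exact (continuous_apply _).comp continuous_fst
    · simp only [dif_neg h]
      exact (continuous_descConj _ _ _ (continuous_apply _)).comp continuous_snd
  have hB := prod_normaliser_smul_integral_pi_descConj_eq_smul_integral_pi_prod_symm hJ
    (fun w : {w : {w : InfinitePlace L // IsComplex w} // w ∈ S'} => chartTorusGLoc L α w.1 S')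
    (fun w => quotientMeasure (chartTorusGLoc L α w.1 S') (t w.1) (isClosed_chartTorusGLoc L α w.1 S') (ν'w w.1)) φ hφT
    (fun _ => K) (fun _ => κ) (fun _ => μN) hμC (fun w => forall_mem_chartTorusGLoc_comm L α w.1 S' (c w.1)) hγt
    (fun w => hτT _) (fun w => hτT _) htms (fun w => c w.1) (fun w => hc.2 w.1 w.2)
    (fun w => hd _) (fun w j => hdc _ j) (fun w => hd _) (fun w j => hdc _ j)
    (quotientMeasure (Subgroup.pi Set.univ (fun w : {w : {w : InfinitePlace L // IsComplex w} // w ∉ S'} => chartTorusGLoc L α w.1 S')) ρcpt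
      (isClosed_coe_pi _ fun w => isClosed_chartTorusGLoc L α w.1 S')
      (Measure.pi fun w : {w : {w : InfinitePlace L // IsComplex w} // w ∉ S'} => ν'w w.1)) _ hFc
  beta_reduce at hB
  rw [Complex.real_smul, Complex.real_smul, Complex.ofReal_prod] at hB
  linear_combination ((∏ w ∈ Finset.univ.filter (fun w => w ∉ S'),
      ((1 - (Circle.exp (c w 1 - c w 0) : ℂ)) * (1 - (Circle.exp (c w 2 - c w 0) : ℂ)) * (1 - (Circle.exp (c w 2 - c w 1) : ℂ)))) *
    (∏ w, ((t w (chartBoxImgGLoc L α w S')).toReal : ℂ))) * hB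

end Assembly

end Literature.NumberTheory.Rogawski1990

end
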